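import Summits.Ventures.YMGap.Census.WindowGeometry
import HarnessLib

/-!
# Venture YMGap, track (b) — which links the decimation windows of `(ℤ/bLℤ)^d` share
# (side conditions for the exact `2`-dimensional integrations of Tomboulis's Prop. III.1)

HONEST FRAMING: venture file of the cell `pub-ymgap` (QuantumFields programme), track (b); lattice bookkeeping only
(arXiv:0707.2179 §2.1: "the integrations over the bonds interior to each 2-face of side length `ba`").  Nothing here
concerns (5.15), limits, confinement or a mass gap.

The window of a coarse plaquette `P = (y, μ < ν)` reads the horizontal links `hLink P s t` (`s < b`, `t ≤ b`) and the
vertical links `vLink P s t` (`s ≤ b`, `t < b`) of `WindowGeometry`.  Its INTERIOR links are `vLink P k t` and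
`hLink P s k` with `1 ≤ k ≤ b - 1` (`s, t < b`).  This file proves that an interior link of `P` is read by no other
window (`hLink_ne_vLink_interior`, `vLink_ne_vLink_interior`, `hLink_ne_hLink_interior`, `vLink_ne_hLink_interior`),
and the distinctness of links inside one window (`vLink_ne_vLink_of_snd_ne`, `…_of_mod_ne`, `hLink_ne_…`), by reading
off coordinates `b·y_κ + (position)` and the uniqueness of division with remainder (`WindowGeometry`).

References: E. T. Tomboulis, arXiv:0707.2179 §2.1 [cite: Tomboulis2007Confinement, §2.1].
-/

noncomputable section

open Finset Function
open Literature.MathematicalPhysics.QuantumFieldTheory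

namespace Summit.Ventures.YMGap.Census

variable {d L b : ℕ} [NeZero b] [NeZero L]

/-! ### Inside one window -/

omit [NeZero b] [NeZero L] in
/-- Horizontal and vertical links of the same window are distinct (different directions). -/
theorem hLink_ne_vLink (P : Plaquette d L) (s t s' t' : ℕ) : hLink b P s t ≠ vLink b P s' t' :=
  fun h => dir_ne P (congrArg Prod.snd h)

/-- Vertical links at different heights `t ≠ t'` (`< b`) are distinct. -/
theorem vLink_ne_vLink_of_snd_ne (P : Plaquette d L) {j k t t' : ℕ} (ht : t < b) (ht' : t' < b) (htt : t ≠ t') :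
    vLink b P j t ≠ vLink b P k t' := by
  intro h
  have h1 := congrFun (congrArg Prod.fst h) P.2.1.2
  simp only [vLink, base_apply_snd] at h1
  exact htt ((scale_add_natCast_eq_iff ht ht').1 h1).2

omit [NeZero b] [NeZero L] in
/-- Vertical links at positions `j ≢ k (mod b)` are distinct. -/
theorem vLink_ne_vLink_of_mod_ne (P : Plaquette d L) {j k : ℕ} (t t' : ℕ) (hjk : j % b ≠ k % b) :
    vLink b P j t ≠ vLink b P k t' := by
  intro h
  have h1 := congrFun (congrArg Prod.fst h) P.2.1.1
  simp only [vLink, base_apply_fst] at h1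
  exact hjk (natCast_mod_eq_of_scale_add_eq h1)

omit [NeZero b] [NeZero L] in
/-- Horizontal links at heights `t ≢ t' (mod b)` are distinct. -/
theorem hLink_ne_hLink_of_mod_ne (P : Plaquette d L) (s s' : ℕ) {t t' : ℕ} (htt : t % b ≠ t' % b) :
    hLink b P s t ≠ hLink b P s' t' := by
  intro h
  have h1 := congrFun (congrArg Prod.fst h) P.2.1.2
  simp only [hLink, base_apply_snd] at h1
  exact htt (natCast_mod_eq_of_scale_add_eq h1)

omit [NeZero b] [NeZero L] in
/-- Horizontal links at positions `s ≢ s' (mod b)` are distinct. -/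
theorem hLink_ne_hLink_of_fst_mod_ne (P : Plaquette d L) {s s' : ℕ} (t t' : ℕ) (hss : s % b ≠ s' % b) :
    hLink b P s t ≠ hLink b P s' t' := by
  intro h
  have h1 := congrFun (congrArg Prod.fst h) P.2.1.1
  simp only [hLink, base_apply_fst] at h1
  exact hss (natCast_mod_eq_of_scale_add_eq h1)

/-! ### Interior links are private to their window -/

/-- Positions `k` with `1 ≤ k < b` and `j ≤ b` with `j ≡ k (mod b)` coincide. -/
theorem eq_of_mod_eq_of_interior {j k : ℕ} (hj : j ≤ b) (hk1 : 1 ≤ k) (hkb : k < b) (h : j % b = k % b) : j = k := by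
  rw [Nat.mod_eq_of_lt hkb] at h
  rcases Nat.lt_or_eq_of_le hj with hj' | rfl
  · rwa [Nat.mod_eq_of_lt hj'] at h
  · rw [Nat.mod_self] at h; omega

omit [NeZero b] [NeZero L] in
/-- From equal orientations and equal coarse coordinates, equal coarse plaquettes (plumbing). -/
theorem plaq_ext {P P' : Plaquette d L} (h2 : P'.2 = P.2) (h1 : ∀ κ, P'.1 κ = P.1 κ) : P' = P :=
  Prod.ext (funext h1) h2

omit [NeZero b] [NeZero L] in
/-- Orientations with the same two directions are equal (plumbing). -/
theorem orient_ext {P P' : Plaquette d L} (hμ : P'.2.1.1 = P.2.1.1) (hν : P'.2.1.2 = P.2.1.2) : P'.2 = P.2 :=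
  Subtype.ext (Prod.ext hμ hν)

/-- **An interior vertical link of `P` is not a vertical link of another window.** -/
theorem vLink_ne_vLink_interior {P P' : Plaquette d L} (hP : P' ≠ P) {s' t' k t : ℕ} (hs' : s' ≤ b) (ht' : t' < b)
    (hk1 : 1 ≤ k) (hkb : k < b) (ht : t < b) : vLink b P' s' t' ≠ vLink b P k t := by
  intro h
  simp only [vLink, Prod.mk.injEq] at h
  obtain ⟨hX, hν⟩ := h
  apply hP
  -- the `μ`-coordinate
  have hμ : P'.2.1.1 = P.2.1.1 := by
    by_contra hne
    have h1 := congrFun hX P.2.1.1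
    rw [base_apply_perp P' s' t' (Ne.symm hne) (hν ▸ dir_ne P), base_apply_fst] at h1
    exact absurd ((scale_eq_scale_add_natCast_iff hkb).1 h1).2 (by omega)
  have h2 := orient_ext hμ hν
  have hμc := congrFun hX P.2.1.1
  rw [show P.2.1.1 = P'.2.1.1 from hμ.symm, base_apply_fst, hμ, base_apply_fst] at hμc
  have hsk : s' = k := eq_of_mod_eq_of_interior hs' hk1 hkb (natCast_mod_eq_of_scale_add_eq hμc)
  subst hsk
  have hyμ := ((scale_add_natCast_eq_iff hkb hkb).1 hμc).1
  have hνc := congrFun hX P.2.1.2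
  rw [show P.2.1.2 = P'.2.1.2 from hν.symm, base_apply_snd, hν, base_apply_snd] at hνc
  have hyν := ((scale_add_natCast_eq_iff ht' ht).1 hνc).1
  refine plaq_ext h2 fun κ => ?_
  by_cases hκ1 : κ = P.2.1.1
  · rw [hκ1]; exact hyμ
  by_cases hκ2 : κ = P.2.1.2
  · rw [hκ2]; exact hyν
  have hc := congrFun hX κ
  rw [base_apply_perp P' _ _ (hμ ▸ hκ1) (hν ▸ hκ2), base_apply_perp P _ _ hκ1 hκ2] at hc
  exact scale_injective hc

/-- **An interior vertical link of `P` is not a horizontal link of another window** (nor of its own). -/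
theorem hLink_ne_vLink_interior {P P' : Plaquette d L} {s' t' k t : ℕ}
    (hk1 : 1 ≤ k) (hkb : k < b) : hLink b P' s' t' ≠ vLink b P k t := by
  intro h
  simp only [hLink, vLink, Prod.mk.injEq] at h
  obtain ⟨hX, hdir⟩ := h
  -- the `μ`-coordinate of `P` is perpendicular to `P'` or its `ν'`
  have hμne : P.2.1.1 ≠ P'.2.1.1 := fun h' => dir_ne P (h'.trans hdir)
  by_cases hμν' : P.2.1.1 = P'.2.1.2
  · -- then `P'` is oriented `(ν, μ)` with `ν < μ`, contradicting `μ < ν`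
    have h1 := P'.2.2
    rw [hdir, ← hμν'] at h1
    exact lt_asymm P.2.2 h1
  · have h1 := congrFun hX P.2.1.1
    rw [base_apply_perp P' s' t' hμne hμν', base_apply_fst] at h1
    exact absurd ((scale_eq_scale_add_natCast_iff hkb).1 h1).2 (by omega)

/-- **An interior horizontal link of `P` is not a horizontal link of another window.** -/
theorem hLink_ne_hLink_interior {P P' : Plaquette d L} (hP : P' ≠ P) {s' t' s k : ℕ} (hs' : s' < b) (ht' : t' ≤ b)
    (hs : s < b) (hk1 : 1 ≤ k) (hkb : k < b) : hLink b P' s' t' ≠ hLink b P s k := by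
  intro h
  simp only [hLink, Prod.mk.injEq] at h
  obtain ⟨hX, hμ⟩ := h
  apply hP
  have hν : P'.2.1.2 = P.2.1.2 := by
    by_contra hne
    have h1 := congrFun hX P.2.1.2
    rw [base_apply_perp P' s' t' (hμ ▸ (dir_ne P).symm) (Ne.symm hne), base_apply_snd] at h1
    exact absurd ((scale_eq_scale_add_natCast_iff hkb).1 h1).2 (by omega)
  have h2 := orient_ext hμ hν
  have hνc := congrFun hX P.2.1.2
  rw [show P.2.1.2 = P'.2.1.2 from hν.symm, base_apply_snd, hν, base_apply_snd] at hνc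
  have htk : t' = k := eq_of_mod_eq_of_interior ht' hk1 hkb (natCast_mod_eq_of_scale_add_eq hνc)
  subst htk
  have hyν := ((scale_add_natCast_eq_iff hkb hkb).1 hνc).1
  have hμc := congrFun hX P.2.1.1
  rw [show P.2.1.1 = P'.2.1.1 from hμ.symm, base_apply_fst, hμ, base_apply_fst] at hμc
  have hyμ := ((scale_add_natCast_eq_iff hs' hs).1 hμc).1
  refine plaq_ext h2 fun κ => ?_
  by_cases hκ1 : κ = P.2.1.1
  · rw [hκ1]; exact hyμ
  by_cases hκ2 : κ = P.2.1.2
  · rw [hκ2]; exact hyν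
  have hc := congrFun hX κ
  rw [base_apply_perp P' _ _ (hμ ▸ hκ1) (hν ▸ hκ2), base_apply_perp P _ _ hκ1 hκ2] at hc
  exact scale_injective hc

/-- **An interior horizontal link of `P` is not a vertical link of another window** (nor of its own). -/
theorem vLink_ne_hLink_interior {P P' : Plaquette d L} {s' t' s k : ℕ}
    (hk1 : 1 ≤ k) (hkb : k < b) : vLink b P' s' t' ≠ hLink b P s k := by
  intro h
  simp only [vLink, hLink, Prod.mk.injEq] at h
  obtain ⟨hX, hdir⟩ := h
  have hνne : P.2.1.2 ≠ P'.2.1.2 := fun h' => dir_ne P (hdir.symm.trans h'.symm)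
  by_cases hνμ' : P.2.1.2 = P'.2.1.1
  · have h1 := P'.2.2
    rw [hdir, ← hνμ'] at h1
    exact lt_asymm P.2.2 h1
  · have h1 := congrFun hX P.2.1.2
    rw [base_apply_perp P' s' t' hνμ' hνne, base_apply_snd] at h1
    exact absurd ((scale_eq_scale_add_natCast_iff hkb).1 h1).2 (by omega)

/-! ### Update invariance of the window link variables -/

omit [NeZero b] [NeZero L] in
/-- Reading a horizontal window link ignores updates at any other link (plumbing). -/
theorem apply_hLink_update {G : Type*} (W : GaugeConfig d (b * L) G) {e : Edge d (b * L)} (g : G) {P : Plaquette d L}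
    {s t : ℕ} (h : hLink b P s t ≠ e) : update W e g (hLink b P s t) = W (hLink b P s t) :=
  update_of_ne h _ _

omit [NeZero b] [NeZero L] in
/-- Reading a vertical window link ignores updates at any other link (plumbing). -/
theorem apply_vLink_update {G : Type*} (W : GaugeConfig d (b * L) G) {e : Edge d (b * L)} (g : G) {P : Plaquette d L}
    {s t : ℕ} (h : vLink b P s t ≠ e) : update W e g (vLink b P s t) = W (vLink b P s t) :=
  update_of_ne h _ _

end Summit.Ventures.YMGap.Census

end
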